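import Summits.NavierStokesRegularity.NavierStokesRegularity.Theorems.EfficiencyFloorNearSaturationNearMaximiserSeqCore
import Summits.NavierStokesRegularity.NavierStokesRegularity.Theorems.EfficiencyFloorNearSaturationNearMaximiserSeqCoreContinuity
import HarnessLib

/-!
# Route `EfficiencyFloor`, crux `NearSaturationNearMaximiser` (stmt-NavierStokesRegularity-25482): the item follows from
# PRECOMPACTNESS MODULO TRANSLATIONS of normalised maximising sequences of the Lu–Doering functional (concentration-compactness form)

By-name helper file (`--supports stmt-NavierStokesRegularity-25482`), assembling `…SeqCore` (p840810: the item ⟸ sequential core)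
with `…SeqCoreContinuity` (p840808: `Z, Pal, S` pass to `Ḣ¹ ∩ Ḣ²` limits). The hypothesis is now in the exact form a
concentration-compactness argument (Lions 1984) delivers for the scale-invariant functional `S/(Z^{3/4}Pal^{3/4})` on `ℝ³` once
vanishing (excluded by the landed `EfficiencyConcentration`, stmt-23111) and dichotomy (penalised by
`…NearSaturationNearMaximiserDichotomy`) are ruled out:

* COMPACTNESS at `c` (hypothesis, def-free): every sequence `v_n` of admissible fields with `Z(v_n) = Pal(v_n) = 1` and
  `S(v_n) → c` has a subsequence `v_{φ(k)}`, translates `a_k ∈ ℝ³` and an admissible `w` with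
  `Z(v_{φ(k)}(· − a_k) − w) → 0` and `Pal(v_{φ(k)}(· − a_k) − w) → 0`.
* `seqCore_of_compact` — COMPACTNESS at `c` ⟹ the SEQUENTIAL CORE at `c` of `…SeqCore` (translation covariance of
  `Z, Pal, S` and admissibility — orbit covariance p839411/p839466 at `l = 1`, `R = 1`; the limit `w` has `Z = Pal = 1` and
  `S(w) = c` by `…SeqCoreContinuity`; translate `w` back).
* `nearSaturationNearMaximiser_of_compact` — BY NAME: COMPACTNESS at the sharp constant ⟹
  `Theses.EfficiencyFloor.NearSaturationNearMaximiser` (stmt-25482).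

HONEST FRAMING: a reduction; the compactness hypothesis is NOT proved here (it is the open concentration-compactness theorem
for the Lu–Doering extremal problem, attainment of `c⋆` included); stmt-25482, `LerayFloorGap`, `ProductionEfficiencyDecay`
(stmt-22866) and Navier–Stokes regularity stay OPEN; no summit statement is proved. [folklore]
-/

-- the problem directory repeats the summit name (`NavierStokesRegularity/NavierStokesRegularity`)
set_option linter.dupNamespace false

noncomputable section

namespace Summit.NavierStokesRegularity.NavierStokesRegularity.Theorems

namespace NearSaturationNearMaximiser

namespace SeqCore

open Set MeasureTheory Filter Topology Function
open scoped InnerProductSpace ENNReal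
open Literature.Analysis.FluidPDE
open MaximiserSetRigidity.OrbitInvariance RigidExit.Resonance

/-! ## §1 Translations `v ↦ v(· − a)` (orbit slices with `l = 1`, `R = 1`) -/

/-- A translate is the orbit slice with unit scaling and trivial rotation (plumbing). [folklore] -/
theorem translate_eq_orbitSlice (m : EuclideanSpace ℝ (Fin 3) → EuclideanSpace ℝ (Fin 3)) (a : EuclideanSpace ℝ (Fin 3)) :
    (fun x => m (x - a)) =
      fun x => (1 : ℝ) • (LinearIsometryEquiv.refl ℝ (EuclideanSpace ℝ (Fin 3)))
        (m ((1 : ℝ) • (LinearIsometryEquiv.refl ℝ (EuclideanSpace ℝ (Fin 3))).symm (x - a))) := by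
  funext x
  simp only [one_smul]
  rfl

/-- Enstrophy, palinstrophy and stretching are translation invariant. [folklore] -/
theorem functionals_translate (m : EuclideanSpace ℝ (Fin 3) → EuclideanSpace ℝ (Fin 3)) (a : EuclideanSpace ℝ (Fin 3)) :
    (∫ x, ‖curl (fun x => m (x - a)) x‖ ^ 2) = (∫ x, ‖curl m x‖ ^ 2) ∧
    (∫ x, frobeniusNormSq (fderiv ℝ (curl (fun x => m (x - a))) x)) = (∫ x, frobeniusNormSq (fderiv ℝ (curl m) x)) ∧
    (∫ x, ⟪curl (fun x => m (x - a)) x, fderiv ℝ (fun x => m (x - a)) x (curl (fun x => m (x - a)) x)⟫_ℝ) =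
      ∫ x, ⟪curl m x, fderiv ℝ m x (curl m x)⟫_ℝ := by
  rw [translate_eq_orbitSlice m a]
  refine ⟨?_, ?_, ?_⟩
  · rw [integral_curl_sq_orbitSlice m a _ one_pos, one_mul]
  · rw [integral_palinstrophy_orbitSlice m a _ one_pos, one_pow, one_mul]
  · rw [integral_stretching_orbitSlice m a _ one_pos, one_pow, one_mul]

/-- Admissibility is translation invariant. [folklore] -/
theorem admissible_translate {m : EuclideanSpace ℝ (Fin 3) → EuclideanSpace ℝ (Fin 3)}
    (hm : ContDiff ℝ (⊤ : ℕ∞) m ∧ VectorCalculus.IsDivFree m ∧ (∫⁻ x, ‖iteratedFDeriv ℝ 0 m x‖ₑ ^ 2 < ⊤) ∧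
      (∫⁻ x, ‖iteratedFDeriv ℝ 1 m x‖ₑ ^ 2 < ⊤) ∧ (∫⁻ x, ‖iteratedFDeriv ℝ 2 m x‖ₑ ^ 2 < ⊤)) (a : EuclideanSpace ℝ (Fin 3)) :
    ContDiff ℝ (⊤ : ℕ∞) (fun x => m (x - a)) ∧ VectorCalculus.IsDivFree (fun x => m (x - a)) ∧
      (∫⁻ x, ‖iteratedFDeriv ℝ 0 (fun x => m (x - a)) x‖ₑ ^ 2 < ⊤) ∧
      (∫⁻ x, ‖iteratedFDeriv ℝ 1 (fun x => m (x - a)) x‖ₑ ^ 2 < ⊤) ∧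
      (∫⁻ x, ‖iteratedFDeriv ℝ 2 (fun x => m (x - a)) x‖ₑ ^ 2 < ⊤) := by
  rw [translate_eq_orbitSlice m a]
  exact admissible_orbitSlice hm a _ one_pos

/-- Translating back: `v − w(· + a) = (v(· − a) − w)(· + a)`, written with `· − (−a)` (plumbing). [folklore] -/
theorem sub_translate_eq (v w : EuclideanSpace ℝ (Fin 3) → EuclideanSpace ℝ (Fin 3)) (a : EuclideanSpace ℝ (Fin 3)) :
    (v - fun x => w (x - -a)) = fun x => ((fun y => v (y - a)) - w) (x - -a) := by
  funext x
  simp only [Pi.sub_apply, sub_neg_eq_add, add_sub_cancel_right]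

/-! ## §2 Compactness modulo translations ⟹ the sequential core ⟹ the item -/

/-- **Precompactness modulo translations of normalised maximising sequences implies the SEQUENTIAL CORE** of `…SeqCore`
at the same constant `c`. [folklore] -/
theorem seqCore_of_compact {c : ℝ}
    (HC : ∀ v : ℕ → EuclideanSpace ℝ (Fin 3) → EuclideanSpace ℝ (Fin 3), (∀ n, ContDiff ℝ (⊤ : ℕ∞) (v n) ∧
      Literature.Analysis.FluidPDE.VectorCalculus.IsDivFree (v n) ∧ (∫⁻ x, ‖iteratedFDeriv ℝ 0 (v n) x‖ₑ ^ 2 < ⊤) ∧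
      (∫⁻ x, ‖iteratedFDeriv ℝ 1 (v n) x‖ₑ ^ 2 < ⊤) ∧ (∫⁻ x, ‖iteratedFDeriv ℝ 2 (v n) x‖ₑ ^ 2 < ⊤)) →
      (∀ n, (∫ x, ‖Literature.Analysis.FluidPDE.curl (v n) x‖ ^ 2) = 1) →
      (∀ n, (∫ x, Literature.Analysis.FluidPDE.frobeniusNormSq (fderiv ℝ (Literature.Analysis.FluidPDE.curl (v n)) x)) = 1) →
      Tendsto (fun n => ∫ x, ⟪Literature.Analysis.FluidPDE.curl (v n) x, fderiv ℝ (v n) x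
        (Literature.Analysis.FluidPDE.curl (v n) x)⟫_ℝ) atTop (𝓝 c) →
      ∃ w : EuclideanSpace ℝ (Fin 3) → EuclideanSpace ℝ (Fin 3), (ContDiff ℝ (⊤ : ℕ∞) w ∧
        Literature.Analysis.FluidPDE.VectorCalculus.IsDivFree w ∧ (∫⁻ x, ‖iteratedFDeriv ℝ 0 w x‖ₑ ^ 2 < ⊤) ∧
        (∫⁻ x, ‖iteratedFDeriv ℝ 1 w x‖ₑ ^ 2 < ⊤) ∧ (∫⁻ x, ‖iteratedFDeriv ℝ 2 w x‖ₑ ^ 2 < ⊤)) ∧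
        ∃ (a : ℕ → EuclideanSpace ℝ (Fin 3)) (φ : ℕ → ℕ), StrictMono φ ∧
        Tendsto (fun k => ∫ x, ‖Literature.Analysis.FluidPDE.curl ((fun x => v (φ k) (x - a k)) - w) x‖ ^ 2) atTop (𝓝 0) ∧
        Tendsto (fun k => ∫ x, Literature.Analysis.FluidPDE.frobeniusNormSq (fderiv ℝ
          (Literature.Analysis.FluidPDE.curl ((fun x => v (φ k) (x - a k)) - w)) x)) atTop (𝓝 0)) :
    ∀ v : ℕ → EuclideanSpace ℝ (Fin 3) → EuclideanSpace ℝ (Fin 3), (∀ n, ContDiff ℝ (⊤ : ℕ∞) (v n) ∧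
      Literature.Analysis.FluidPDE.VectorCalculus.IsDivFree (v n) ∧ (∫⁻ x, ‖iteratedFDeriv ℝ 0 (v n) x‖ₑ ^ 2 < ⊤) ∧
      (∫⁻ x, ‖iteratedFDeriv ℝ 1 (v n) x‖ₑ ^ 2 < ⊤) ∧ (∫⁻ x, ‖iteratedFDeriv ℝ 2 (v n) x‖ₑ ^ 2 < ⊤)) →
      (∀ n, (∫ x, ‖Literature.Analysis.FluidPDE.curl (v n) x‖ ^ 2) = 1) →
      (∀ n, (∫ x, Literature.Analysis.FluidPDE.frobeniusNormSq (fderiv ℝ (Literature.Analysis.FluidPDE.curl (v n)) x)) = 1) →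
      Tendsto (fun n => ∫ x, ⟪Literature.Analysis.FluidPDE.curl (v n) x, fderiv ℝ (v n) x
        (Literature.Analysis.FluidPDE.curl (v n) x)⟫_ℝ) atTop (𝓝 c) →
      ∀ ε : ℝ, 0 < ε → ∃ n : ℕ, ∃ m : EuclideanSpace ℝ (Fin 3) → EuclideanSpace ℝ (Fin 3), (ContDiff ℝ (⊤ : ℕ∞) m ∧
        Literature.Analysis.FluidPDE.VectorCalculus.IsDivFree m ∧ (∫⁻ x, ‖iteratedFDeriv ℝ 0 m x‖ₑ ^ 2 < ⊤) ∧
        (∫⁻ x, ‖iteratedFDeriv ℝ 1 m x‖ₑ ^ 2 < ⊤) ∧ (∫⁻ x, ‖iteratedFDeriv ℝ 2 m x‖ₑ ^ 2 < ⊤)) ∧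
        (∫ x, ‖Literature.Analysis.FluidPDE.curl m x‖ ^ 2) = 1 ∧
        (∫ x, Literature.Analysis.FluidPDE.frobeniusNormSq (fderiv ℝ (Literature.Analysis.FluidPDE.curl m) x)) = 1 ∧
        (∫ x, ⟪Literature.Analysis.FluidPDE.curl m x, fderiv ℝ m x (Literature.Analysis.FluidPDE.curl m x)⟫_ℝ) = c ∧
        (∫ x, ‖Literature.Analysis.FluidPDE.curl (v n - m) x‖ ^ 2) ≤ ε ^ 2 ∧
        (∫ x, Literature.Analysis.FluidPDE.frobeniusNormSq (fderiv ℝ (Literature.Analysis.FluidPDE.curl (v n - m)) x)) ≤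
          ε ^ 2 := by
  intro v hAdm hZ1 hP1 hS ε hε
  obtain ⟨w, hw, a, φ, hφ, hZlim, hPlim⟩ := HC v hAdm hZ1 hP1 hS
  -- the translated subsequence `u k = v (φ k) (· − a k)`
  have huAdm : ∀ k, ContDiff ℝ (⊤ : ℕ∞) (fun x => v (φ k) (x - a k)) ∧
      VectorCalculus.IsDivFree (fun x => v (φ k) (x - a k)) ∧
      (∫⁻ x, ‖iteratedFDeriv ℝ 0 (fun x => v (φ k) (x - a k)) x‖ₑ ^ 2 < ⊤) ∧
      (∫⁻ x, ‖iteratedFDeriv ℝ 1 (fun x => v (φ k) (x - a k)) x‖ₑ ^ 2 < ⊤) ∧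
      (∫⁻ x, ‖iteratedFDeriv ℝ 2 (fun x => v (φ k) (x - a k)) x‖ₑ ^ 2 < ⊤) := fun k => admissible_translate (hAdm (φ k)) (a k)
  have huZ : ∀ k, (∫ x, ‖curl (fun x => v (φ k) (x - a k)) x‖ ^ 2) = 1 := fun k =>
    (functionals_translate (v (φ k)) (a k)).1.trans (hZ1 (φ k))
  have huP : ∀ k, (∫ x, frobeniusNormSq (fderiv ℝ (curl (fun x => v (φ k) (x - a k))) x)) = 1 := fun k =>
    (functionals_translate (v (φ k)) (a k)).2.1.trans (hP1 (φ k))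
  -- the limit field is an exact normalised maximiser: `Z = Pal = 1`, `S = c`
  have hZw : (∫ x, ‖curl w x‖ ^ 2) = 1 :=
    enstrophy_eq_one_of_tendsto (fun k => (huAdm k).1) (fun k => (huAdm k).2.2.2.1) hw.1 hw.2.2.2.1 huZ hZlim
  have hPw : (∫ x, frobeniusNormSq (fderiv ℝ (curl w) x)) = 1 :=
    palinstrophy_eq_one_of_tendsto (fun k => (huAdm k).1) (fun k => (huAdm k).2.2.2.2) hw.1 hw.2.2.2.2 huP hPlim
  have hSlim : Tendsto (fun k => ∫ x, ⟪curl (fun x => v (φ k) (x - a k)) x, fderiv ℝ (fun x => v (φ k) (x - a k)) x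
      (curl (fun x => v (φ k) (x - a k)) x)⟫_ℝ) atTop (𝓝 (∫ x, ⟪curl w x, fderiv ℝ w x (curl w x)⟫_ℝ)) :=
    stretching_tendsto huAdm hw huZ huP hZlim hPlim
  have hSlim' : Tendsto (fun k => ∫ x, ⟪curl (fun x => v (φ k) (x - a k)) x, fderiv ℝ (fun x => v (φ k) (x - a k)) x
      (curl (fun x => v (φ k) (x - a k)) x)⟫_ℝ) atTop (𝓝 c) := by
    refine (hS.comp hφ.tendsto_atTop).congr fun k => ?_
    exact ((functionals_translate (v (φ k)) (a k)).2.2).symm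
  have hSw : (∫ x, ⟪curl w x, fderiv ℝ w x (curl w x)⟫_ℝ) = c := tendsto_nhds_unique hSlim hSlim'
  -- a term of the translated subsequence `ε`-close to `w`; translate `w` back
  have hev : ∀ᶠ k in atTop, (∫ x, ‖curl ((fun x => v (φ k) (x - a k)) - w) x‖ ^ 2) ≤ ε ^ 2 ∧
      (∫ x, frobeniusNormSq (fderiv ℝ (curl ((fun x => v (φ k) (x - a k)) - w)) x)) ≤ ε ^ 2 :=
    (hZlim.eventually (ge_mem_nhds (by positivity))).and (hPlim.eventually (ge_mem_nhds (by positivity)))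
  obtain ⟨k, hkZ, hkP⟩ := hev.exists
  refine ⟨φ k, fun x => w (x - -a k), admissible_translate hw (-a k), (functionals_translate w (-a k)).1.trans hZw,
    (functionals_translate w (-a k)).2.1.trans hPw, (functionals_translate w (-a k)).2.2.trans hSw, ?_, ?_⟩
  · rw [sub_translate_eq (v (φ k)) w (a k), (functionals_translate ((fun y => v (φ k) (y - a k)) - w) (-a k)).1]
    exact hkZ
  · rw [sub_translate_eq (v (φ k)) w (a k), (functionals_translate ((fun y => v (φ k) (y - a k)) - w) (-a k)).2.1]
    exact hkP

/-- **`NearSaturationNearMaximiser` (stmt-25482) from concentration-compactness, BY NAME.** If for the sharp one-sided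
Lu–Doering constant `c⋆` (the item's sharp-constant clause, verbatim) every sequence of admissible fields normalised to
`Z = Pal = 1` with `S → c⋆` is precompact in `Ḣ¹ ∩ Ḣ²` modulo translations (a subsequence of translates converges to an
admissible field: `Z`, `Pal` of the difference `→ 0`), then the route decl `Theses.EfficiencyFloor.NearSaturationNearMaximiser`
holds (`seqCore_of_compact` + `nearSaturationNearMaximiser_of_seqCore`, p840810). The hypothesis is the OPEN
concentration-compactness theorem for the Lu–Doering extremal problem (attainment of `c⋆` included); it is NOT proved here. [folklore] -/
theorem nearSaturationNearMaximiser_of_compact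
    (HC : ∀ c : ℝ, (0 < c ∧ (∀ v : EuclideanSpace ℝ (Fin 3) → EuclideanSpace ℝ (Fin 3), (ContDiff ℝ (⊤ : ℕ∞) v ∧
      Literature.Analysis.FluidPDE.VectorCalculus.IsDivFree v ∧ (∫⁻ x, ‖iteratedFDeriv ℝ 0 v x‖ₑ ^ 2 < ⊤) ∧
      (∫⁻ x, ‖iteratedFDeriv ℝ 1 v x‖ₑ ^ 2 < ⊤) ∧ (∫⁻ x, ‖iteratedFDeriv ℝ 2 v x‖ₑ ^ 2 < ⊤)) → (∫ x,
      ⟪Literature.Analysis.FluidPDE.curl v x, fderiv ℝ v x (Literature.Analysis.FluidPDE.curl v x)⟫_ℝ) ≤ c *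
      (∫ x, ‖Literature.Analysis.FluidPDE.curl v x‖ ^ 2) ^ (3 / 4 : ℝ) * (∫ x,
      Literature.Analysis.FluidPDE.frobeniusNormSq (fderiv ℝ (Literature.Analysis.FluidPDE.curl v) x)) ^ (3 /
      4 : ℝ)) ∧ ∀ c' : ℝ, (∀ w : EuclideanSpace ℝ (Fin 3) → EuclideanSpace ℝ (Fin 3), (ContDiff ℝ (⊤ : ℕ∞) w ∧
      Literature.Analysis.FluidPDE.VectorCalculus.IsDivFree w ∧ (∫⁻ x, ‖iteratedFDeriv ℝ 0 w x‖ₑ ^ 2 < ⊤) ∧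
      (∫⁻ x, ‖iteratedFDeriv ℝ 1 w x‖ₑ ^ 2 < ⊤) ∧ (∫⁻ x, ‖iteratedFDeriv ℝ 2 w x‖ₑ ^ 2 < ⊤)) → (∫ x,
      ⟪Literature.Analysis.FluidPDE.curl w x, fderiv ℝ w x (Literature.Analysis.FluidPDE.curl w x)⟫_ℝ) ≤ c' *
      (∫ x, ‖Literature.Analysis.FluidPDE.curl w x‖ ^ 2) ^ (3 / 4 : ℝ) * (∫ x,
      Literature.Analysis.FluidPDE.frobeniusNormSq (fderiv ℝ (Literature.Analysis.FluidPDE.curl w) x)) ^ (3 /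
      4 : ℝ)) → c ≤ c') →
      ∀ v : ℕ → EuclideanSpace ℝ (Fin 3) → EuclideanSpace ℝ (Fin 3), (∀ n, ContDiff ℝ (⊤ : ℕ∞) (v n) ∧
      Literature.Analysis.FluidPDE.VectorCalculus.IsDivFree (v n) ∧ (∫⁻ x, ‖iteratedFDeriv ℝ 0 (v n) x‖ₑ ^ 2 < ⊤) ∧
      (∫⁻ x, ‖iteratedFDeriv ℝ 1 (v n) x‖ₑ ^ 2 < ⊤) ∧ (∫⁻ x, ‖iteratedFDeriv ℝ 2 (v n) x‖ₑ ^ 2 < ⊤)) →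
      (∀ n, (∫ x, ‖Literature.Analysis.FluidPDE.curl (v n) x‖ ^ 2) = 1) →
      (∀ n, (∫ x, Literature.Analysis.FluidPDE.frobeniusNormSq (fderiv ℝ (Literature.Analysis.FluidPDE.curl (v n)) x)) = 1) →
      Tendsto (fun n => ∫ x, ⟪Literature.Analysis.FluidPDE.curl (v n) x, fderiv ℝ (v n) x
        (Literature.Analysis.FluidPDE.curl (v n) x)⟫_ℝ) atTop (𝓝 c) →
      ∃ w : EuclideanSpace ℝ (Fin 3) → EuclideanSpace ℝ (Fin 3), (ContDiff ℝ (⊤ : ℕ∞) w ∧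
        Literature.Analysis.FluidPDE.VectorCalculus.IsDivFree w ∧ (∫⁻ x, ‖iteratedFDeriv ℝ 0 w x‖ₑ ^ 2 < ⊤) ∧
        (∫⁻ x, ‖iteratedFDeriv ℝ 1 w x‖ₑ ^ 2 < ⊤) ∧ (∫⁻ x, ‖iteratedFDeriv ℝ 2 w x‖ₑ ^ 2 < ⊤)) ∧
        ∃ (a : ℕ → EuclideanSpace ℝ (Fin 3)) (φ : ℕ → ℕ), StrictMono φ ∧
        Tendsto (fun k => ∫ x, ‖Literature.Analysis.FluidPDE.curl ((fun x => v (φ k) (x - a k)) - w) x‖ ^ 2) atTop (𝓝 0) ∧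
        Tendsto (fun k => ∫ x, Literature.Analysis.FluidPDE.frobeniusNormSq (fderiv ℝ
          (Literature.Analysis.FluidPDE.curl ((fun x => v (φ k) (x - a k)) - w)) x)) atTop (𝓝 0)) :
    Summit.NavierStokesRegularity.NavierStokesRegularity.Theses.EfficiencyFloor.NearSaturationNearMaximiser :=
  nearSaturationNearMaximiser_of_seqCore fun c hsharp => seqCore_of_compact (HC c hsharp)

end SeqCore

end NearSaturationNearMaximiser

end Summit.NavierStokesRegularity.NavierStokesRegularity.Theorems

end
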